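import Summits.NavierStokesRegularity.NavierStokesRegularity.Theses.RecurrentProfiles
import Summits.NavierStokesRegularity.NavierStokesRegularity.Theses.SqueezeCycle
import Summits.NavierStokesRegularity.NavierStokesRegularity.Theorems.RecurrentProfilesRecurrentLiouvilleClockConstantinWindow
import Summits.NavierStokesRegularity.NavierStokesRegularity.Theorems.RecurrentProfilesRecurrentLiouvilleClockVorticityFloor
import Summits.NavierStokesRegularity.NavierStokesRegularity.Theorems.RecurrentProfilesRecurrentReduction
import Summits.NavierStokesRegularity.NavierStokesRegularity.Theorems.SqueezeCycleExtremalElementExistsRegularity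
import Summits.NavierStokesRegularity.NavierStokesRegularity.Theorems.SqueezeCycleExtremalBiaxialitySubcriticalGaugeStrainBound
import Literature.Analysis.FluidPDE.TypeIRateOseenMildRepresentative
import Literature.Analysis.FluidPDE.LocalTypeICongr
import Literature.Analysis.FluidPDE.LocalTypeILiouville
import Literature.Analysis.FluidPDE.TypeIAncientMild
import Literature.Analysis.FluidPDE.ElgindiBlowup
import HarnessLib

/-!
# Crux `RecurrentLiouville` (stmt-NavierStokesRegularity-1589), line `Sketch` (ideator 4, stretching
# clock) — stub `stub_clockKeepsClock`: every Type-I singularity model keeps the logarithmic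
# stretching clock

Theorems-only file.  **Main result** (`stub_clockKeepsClock`, registered): let `(u, p)` be a
suitable weak solution of Navier–Stokes (`ν = 1`) on the backward slab with weak gradient `G`,
Albritton–Barker `𝐈 < ⊤`, the rate `‖u‖ ≤ C/√(−t)` and a backward-SINGULAR origin, and let
`v ∈ A_C` be its Type-I ancient mild representative (`u = v` a.e.).  Then there is ONE constant
`K = K(profile)` such that on EVERY window `t₀ < t₁ < 0`, every continuous majorant `Λ` of the
strain form (`⟪∇v(t,x)ξ, ξ⟫ ≤ Λ(t)‖ξ‖²` on the window) satisfies

`log(t₀/t₁) − K ≤ ∫_{t₀}^{t₁} Λ(t) dt`.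

In Leray's log-time `s = −log(−t)` this says that the window mean of `sup_x (−t)λ₁(∇v)` is at
least `1 − K/(s₁ − s₀)`: cumulative maximal stretching keeps the clock of the self-similar collapse
with slope EXACTLY `1`, the vorticity dilution rate.  Recurrence is not used (Disproof §A3): this
is a constraint on every hypothetical Type-I singularity model (portrait clause for
`Theorems/RecurrentLiouville/Negative/CounterexamplePortrait.lean`; for an a.e. `λ`-DSS model it is
the period-average form "∮ sup_y λ₁(∇U) ds ≥ period").

Proof: Constantin's window inequality (`stub_clockConstantinWindow`, p138176) propagates the
class-uniform gauge pin `‖ω(t₀, ·)‖ ≤ K₁/(−t₀)` (KNSS Prop. 4.1) to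
`‖ω(t₁, x)‖ ≤ K₁/(−t₀) · e^{∫Λ}`, while the vorticity floor of the singular profile
(`stub_clockVorticityFloor`, p138292) gives a point with `κ/(−t₁) ≤ ‖ω(t₁, x₁)‖`; take logarithms,
`K = log(K₁/κ)`.

Corollary (`clock_epochDensity`): strain-active epochs — times at which
somewhere `(−t)⟪∇v ξ, ξ⟫ > (1 − δ)‖ξ‖²` — have logarithmic density at least `δ/(K₁ − 1 + δ)` in
every long window (the card's K2′).

## References

* P. Constantin, Comm. Math. Phys. 129 (1990) 241–266, (2.9); SIAM Review 36 (1994) 73–98.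
* G. Koch, N. Nadirashvili, G. Seregin, V. Šverák, Acta Math. 203 (2009), Prop. 4.1, Lemma 6.1.
* D. Albritton, T. Barker, J. Math. Fluid Mech. 21 (2019), Thm 1.1, Lemma 2.2, Prop. 2.3.
-/

noncomputable section

-- the sub-problem namespace repeats the summit name (D-0017 layout `Summit.<S>.<P>.Theorems`)
set_option linter.dupNamespace false

namespace Summit.NavierStokesRegularity.NavierStokesRegularity.Theorems

open MeasureTheory Set Function Filter Topology TopologicalSpace Metric
open Literature.Analysis Literature.Analysis.FluidPDE
open scoped NNReal ENNReal RealInnerProductSpace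

/-! ### The representative and the upper pin -/

/-- **The Type-I ancient mild representative of a class profile** (A–B Thm 1.1 forward direction on
the slab + KNSS Prop. 4.1): `u = v` a.e. on the slab with `v ∈ A_C`.
[cite: AlbrittonBarker2019, Thm 1.1 (forward direction, §3)] -/
theorem clockKC_exists_typeI_repr
    {u : ℝ → EuclideanSpace ℝ (Fin 3) → EuclideanSpace ℝ (Fin 3)}
    {p : ℝ → EuclideanSpace ℝ (Fin 3) → ℝ}
    {G : ℝ → EuclideanSpace ℝ (Fin 3) → EuclideanSpace ℝ (Fin 3) →L[ℝ] EuclideanSpace ℝ (Fin 3)}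
    {C : ℝ}
    (hsw : IsSuitableWeakSolutionOn (slab (EuclideanSpace ℝ (Fin 3)) (Iio 0) isOpen_Iio) 1 0 u p)
    (hI : typeIBound (Iio (0 : ℝ) ×ˢ univ) u p G < ⊤) (hdec : HasTypeITimeDecay C u) :
    ∃ v : ℝ → EuclideanSpace ℝ (Fin 3) → EuclideanSpace ℝ (Fin 3),
      IsTypeIAncientMild C v ∧
      ∀ᵐ z ∂(volume.restrict (Iio (0 : ℝ) ×ˢ (univ : Set (EuclideanSpace ℝ (Fin 3))))),
        uncurry u z = uncurry v z := by
  obtain ⟨v, hae, hcont, hdiv, hmild, hrate⟩ :=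
    exists_oseenMild_repr_of_typeIBound_lt_top hsw hdec hI
  exact ⟨v, isTypeIAncientMild_of_continuous_oseenMild hcont hdiv hmild hrate, hae⟩

/-- The origin is a backward singular point of the representative as well (the backward balls at the
origin lie in the slab; `L^∞` norms are essential). -/
theorem clockKC_singular_repr
    {u v : ℝ → EuclideanSpace ℝ (Fin 3) → EuclideanSpace ℝ (Fin 3)}
    (hae : ∀ᵐ z ∂(volume.restrict (Iio (0 : ℝ) ×ˢ (univ : Set (EuclideanSpace ℝ (Fin 3))))),
      uncurry u z = uncurry v z)
    (hsing : IsBackwardSingularPoint u 0) : IsBackwardSingularPoint v 0 :=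
  hsing.congr_ae (fun r _ => parabolicCylinder_origin_subset_slab r) hae

/-- **Upper vorticity pin** (KNSS gauge bound): `‖curl v(t, x)‖ ≤ K₁(C)/(−t)` on `A_C`, `K₁ > 0`.
[cite: KochNadirashviliSereginSverak2009, Prop. 4.1 (4.10) with k = 1] -/
theorem clockKC_upper_pin (C : ℝ) :
    ∃ K₁ : ℝ, 0 < K₁ ∧ ∀ ⦃v : ℝ → EuclideanSpace ℝ (Fin 3) → EuclideanSpace ℝ (Fin 3)⦄,
      IsTypeIAncientMild C v → ∀ t < 0, ∀ x, ‖curl (v t) x‖ ≤ K₁ / (-t) := by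
  obtain ⟨K₀, hK₀⟩ := exists_gauge_norm_fderiv_le_of_typeI C
  refine ⟨4 * |K₀| + 1, by positivity, fun v hv t ht x => ?_⟩
  have ht' : 0 < -t := neg_pos.2 ht
  have h1 : ‖curl (v t) x‖ ≤ 4 * ‖fderiv ℝ (v t) x‖ := norm_curl_le_four_mul (v t) x
  have h2 : (-t) * ‖fderiv ℝ (v t) x‖ ≤ K₀ := hK₀ hv t ht x
  rw [le_div_iff₀ ht']
  calc ‖curl (v t) x‖ * -t ≤ 4 * ‖fderiv ℝ (v t) x‖ * -t := by gcongr
    _ = 4 * ((-t) * ‖fderiv ℝ (v t) x‖) := by ring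
    _ ≤ 4 * |K₀| := by nlinarith [le_abs_self K₀]
    _ ≤ 4 * |K₀| + 1 := by linarith

/-! ### The clock law -/

/-- **Every Type-I singularity model keeps the logarithmic stretching clock** (registered stub
`stub_clockKeepsClock` of line `Sketch`; recurrence-free).  For the Type-I ancient mild
representative `v` of an origin-singular Albritton–Barker class profile there is ONE constant `K`
such that on EVERY window `t₀ < t₁ < 0`, every continuous majorant `Λ` of the strain form on the
window has `log(t₀/t₁) − K ≤ ∫_{t₀}^{t₁} Λ` (`K = log(K₁/κ)`: `κ` the floor of
`stub_clockVorticityFloor`, `K₁/(−t)` the gauge pin, propagated by `stub_clockConstantinWindow`).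
[cite: Constantin1990, (2.9)] -/
theorem stub_clockKeepsClock :
    ∀ (C : ℝ) (u : ℝ → EuclideanSpace ℝ (Fin 3) → EuclideanSpace ℝ (Fin 3))
      (p : ℝ → EuclideanSpace ℝ (Fin 3) → ℝ)
      (G : ℝ → EuclideanSpace ℝ (Fin 3) → EuclideanSpace ℝ (Fin 3) →L[ℝ] EuclideanSpace ℝ (Fin 3))
      (v : ℝ → EuclideanSpace ℝ (Fin 3) → EuclideanSpace ℝ (Fin 3)),
      IsSuitableWeakSolutionOn (slab (EuclideanSpace ℝ (Fin 3)) (Iio 0) isOpen_Iio) 1 0 u p →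
      HasWeakSpatialGradientOn (slab (EuclideanSpace ℝ (Fin 3)) (Iio 0) isOpen_Iio) u G →
      typeIBound (Iio (0 : ℝ) ×ˢ univ) u p G < ⊤ →
      HasTypeITimeDecay C u →
      IsBackwardSingularPoint u 0 →
      IsTypeIAncientMild C v →
      (∀ᵐ z ∂(volume.restrict (Iio (0 : ℝ) ×ˢ (univ : Set (EuclideanSpace ℝ (Fin 3))))),
        uncurry u z = uncurry v z) →
      ∃ K : ℝ, ∀ (t₀ t₁ : ℝ), t₀ < t₁ → t₁ < 0 → ∀ (Λ : ℝ → ℝ), Continuous Λ →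
        (∀ t ∈ Set.Icc t₀ t₁, ∀ (x ξ : EuclideanSpace ℝ (Fin 3)),
          ⟪fderiv ℝ (v t) x ξ, ξ⟫ ≤ Λ t * ‖ξ‖ ^ 2) →
        Real.log (t₀ / t₁) - K ≤ ∫ t in t₀..t₁, Λ t := by
  intro C u p G v hsw hwg hI hdec hsing hv hae
  obtain ⟨κ, hκ, hfloor⟩ := stub_clockVorticityFloor C u p G v hsw hwg hI hdec hsing hv hae
  obtain ⟨K₁, hK₁, hup⟩ := clockKC_upper_pin C
  refine ⟨Real.log (K₁ / κ), fun t₀ t₁ h01 ht₁ Λ hΛ hmaj => ?_⟩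
  have h0 : t₀ < 0 := h01.trans ht₁
  have ht0 : 0 < -t₀ := neg_pos.2 h0
  have ht1 : 0 < -t₁ := neg_pos.2 ht₁
  -- the upper pin at `t₀`, propagated to `t₁` by Constantin's inequality
  have hA : ∀ y, ‖curl (v t₀) y‖ ≤ K₁ / (-t₀) := fun y => hup hv t₀ h0 y
  have hprop := stub_clockConstantinWindow C v hv t₀ t₁ h01 ht₁ Λ hΛ hmaj (K₁ / (-t₀)) hA
  -- the floor at `t₁`
  obtain ⟨x₁, hx₁⟩ := hfloor t₁ ht₁
  have hchain : κ / (-t₁) ≤ K₁ / (-t₀) * Real.exp (∫ t in t₀..t₁, Λ t) := by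
    rw [div_le_iff₀ ht1]
    calc κ ≤ (-t₁) * ‖curl (v t₁) x₁‖ := hx₁
      _ ≤ (-t₁) * (K₁ / (-t₀) * Real.exp (∫ t in t₀..t₁, Λ t)) := by
          gcongr
          exact hprop x₁
      _ = K₁ / (-t₀) * Real.exp (∫ t in t₀..t₁, Λ t) * (-t₁) := by ring
  -- take logarithms
  have hpos : 0 < κ / (-t₁) := div_pos hκ ht1
  have hlog := Real.log_le_log hpos hchain
  rw [Real.log_mul (div_pos hK₁ ht0).ne' (Real.exp_pos _).ne', Real.log_exp,
    Real.log_div hκ.ne' ht1.ne', Real.log_div hK₁.ne' ht0.ne'] at hlog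
  have e1 : Real.log (t₀ / t₁) = Real.log (-t₀) - Real.log (-t₁) := by
    rw [show t₀ / t₁ = (-t₀) / (-t₁) by rw [neg_div_neg_eq], Real.log_div ht0.ne' ht1.ne']
  have e2 : Real.log (K₁ / κ) = Real.log K₁ - Real.log κ := Real.log_div hK₁.ne' hκ.ne'
  rw [e1, e2]
  linarith

/-- **The clock law on the class** (quantifier form consumed downstream: the representative is
produced inside).  For an origin-singular class profile `(u, p, G, C)` there are `v ∈ A_C` with
`u = v` a.e. and a constant `K` with the clock inequality on every window. -/
theorem clockKC_keepsClock_class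
    {u : ℝ → EuclideanSpace ℝ (Fin 3) → EuclideanSpace ℝ (Fin 3)}
    {p : ℝ → EuclideanSpace ℝ (Fin 3) → ℝ}
    {G : ℝ → EuclideanSpace ℝ (Fin 3) → EuclideanSpace ℝ (Fin 3) →L[ℝ] EuclideanSpace ℝ (Fin 3)}
    {C : ℝ}
    (hsw : IsSuitableWeakSolutionOn (slab (EuclideanSpace ℝ (Fin 3)) (Iio 0) isOpen_Iio) 1 0 u p)
    (hwg : HasWeakSpatialGradientOn (slab (EuclideanSpace ℝ (Fin 3)) (Iio 0) isOpen_Iio) u G)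
    (hI : typeIBound (Iio (0 : ℝ) ×ˢ univ) u p G < ⊤) (hdec : HasTypeITimeDecay C u)
    (hsing : IsBackwardSingularPoint u 0) :
    ∃ v : ℝ → EuclideanSpace ℝ (Fin 3) → EuclideanSpace ℝ (Fin 3),
      IsTypeIAncientMild C v ∧
      (∀ᵐ z ∂(volume.restrict (Iio (0 : ℝ) ×ˢ (univ : Set (EuclideanSpace ℝ (Fin 3))))),
        uncurry u z = uncurry v z) ∧
      IsBackwardSingularPoint v 0 ∧
      ∃ K : ℝ, ∀ (t₀ t₁ : ℝ), t₀ < t₁ → t₁ < 0 → ∀ (Λ : ℝ → ℝ), Continuous Λ →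
        (∀ t ∈ Set.Icc t₀ t₁, ∀ (x ξ : EuclideanSpace ℝ (Fin 3)),
          ⟪fderiv ℝ (v t) x ξ, ξ⟫ ≤ Λ t * ‖ξ‖ ^ 2) →
        Real.log (t₀ / t₁) - K ≤ ∫ t in t₀..t₁, Λ t := by
  obtain ⟨v, hv, hae⟩ := clockKC_exists_typeI_repr hsw hI hdec
  exact ⟨v, hv, hae, clockKC_singular_repr hae hsing,
    stub_clockKeepsClock C u p G v hsw hwg hI hdec hsing hv hae⟩

/-! ### The epoch-density corollary of the clock law (the card's K2′) -/

/-- **Strain-active epochs have positive logarithmic density** (the card's K2′, abstract form: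
the clock law on the window is the hypothesis `hclock`).  On a window `t₀ < t₁ < 0` let the strain
form of `v` obey the gauge bound `(−t)⟪∇v ξ, ξ⟫ ≤ K₁‖ξ‖²` (`K₁ ≥ 1`) and the clock law with
constant `K` (every continuous majorant `Λ` of the strain form has `log(t₀/t₁) − K ≤ ∫Λ`).  Call
`t` ACTIVE if somewhere `(−t)⟪∇v ξ, ξ⟫ > (1 − δ)‖ξ‖²` (`0 < δ`).  Then every continuous
`χ ≥ 0` with `χ ≥ 1` at active times has `∫_{t₀}^{t₁} χ(t) dt/(−t) ≥ θ log(t₀/t₁) − K/(K₁−1+δ)`,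
`θ = δ/(K₁ − 1 + δ)`: the active epochs fill a definite fraction of every long window in log-time.
Proof: the clock law applied to the majorant `Λ = ((1−δ) + (K₁−1+δ) min(χ,1))/(−t)`. -/
theorem clock_epochDensity {t₀ t₁ K K₁ δ : ℝ} (h01 : t₀ < t₁) (h1 : t₁ < 0) (hK₁ : 1 ≤ K₁)
    (hδ0 : 0 < δ)
    {v : ℝ → EuclideanSpace ℝ (Fin 3) → EuclideanSpace ℝ (Fin 3)}
    (hgauge : ∀ t ∈ Set.Icc t₀ t₁, ∀ (x ξ : EuclideanSpace ℝ (Fin 3)),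
      (-t) * ⟪fderiv ℝ (v t) x ξ, ξ⟫ ≤ K₁ * ‖ξ‖ ^ 2)
    (hclock : ∀ Λ : ℝ → ℝ, Continuous Λ →
      (∀ t ∈ Set.Icc t₀ t₁, ∀ (x ξ : EuclideanSpace ℝ (Fin 3)),
        ⟪fderiv ℝ (v t) x ξ, ξ⟫ ≤ Λ t * ‖ξ‖ ^ 2) →
      Real.log (t₀ / t₁) - K ≤ ∫ t in t₀..t₁, Λ t)
    (χ : ℝ → ℝ) (hχ : Continuous χ) (hχ0 : ∀ t, 0 ≤ χ t)
    (hact : ∀ t ∈ Set.Icc t₀ t₁,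
      (∃ (x ξ : EuclideanSpace ℝ (Fin 3)), (1 - δ) * ‖ξ‖ ^ 2 < (-t) * ⟪fderiv ℝ (v t) x ξ, ξ⟫) →
      1 ≤ χ t) :
    δ / (K₁ - 1 + δ) * Real.log (t₀ / t₁) - K / (K₁ - 1 + δ) ≤ ∫ t in t₀..t₁, χ t / (-t) := by
  have h0 : t₀ < 0 := h01.trans h1
  have ht1 : 0 < -t₁ := neg_pos.2 h1
  set D : ℝ := K₁ - 1 + δ with hD
  have hD0 : 0 < D := by rw [hD]; linarith
  -- a positive continuous denominator agreeing with `-t` on the window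
  set d : ℝ → ℝ := fun t => max (-t) (-t₁) with hd
  have hdc : Continuous d := by fun_prop
  have hdpos : ∀ t, 0 < d t := fun t => ht1.trans_le (le_max_right _ _)
  have hdw : ∀ t ∈ Set.Icc t₀ t₁, d t = -t := fun t ht => max_eq_left (by linarith [ht.2])
  -- the majorant
  set Λ : ℝ → ℝ := fun t => ((1 - δ) + D * min (χ t) 1) / d t with hΛ
  have hΛc : Continuous Λ := by
    refine Continuous.div (by fun_prop) hdc fun t => (hdpos t).ne'
  have hmaj : ∀ t ∈ Set.Icc t₀ t₁, ∀ (x ξ : EuclideanSpace ℝ (Fin 3)),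
      ⟪fderiv ℝ (v t) x ξ, ξ⟫ ≤ Λ t * ‖ξ‖ ^ 2 := by
    intro t ht x ξ
    have htneg : 0 < -t := by linarith [ht.2]
    have hmin0 : 0 ≤ min (χ t) 1 := le_min (hχ0 t) zero_le_one
    rw [hΛ]; dsimp only; rw [hdw t ht]
    by_cases hcase : (1 - δ) * ‖ξ‖ ^ 2 < (-t) * ⟪fderiv ℝ (v t) x ξ, ξ⟫
    · -- active: `χ t ≥ 1`, the majorant is `K₁/(−t)`
      have hχ1 : min (χ t) 1 = 1 := min_eq_right (hact t ht ⟨x, ξ, hcase⟩)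
      rw [hχ1, mul_one, show (1 - δ + D) = K₁ by rw [hD]; ring]
      rw [div_mul_eq_mul_div, le_div_iff₀ htneg]
      linarith [hgauge t ht x ξ]
    · push Not at hcase
      have h2 : (1 - δ) / (-t) * ‖ξ‖ ^ 2 ≤ (1 - δ + D * min (χ t) 1) / (-t) * ‖ξ‖ ^ 2 := by
        gcongr
        nlinarith
      refine le_trans ?_ h2
      rw [div_mul_eq_mul_div, le_div_iff₀ htneg]
      linarith
  have hcl := hclock Λ hΛc hmaj
  -- compare `∫Λ` with `(1−δ) log(t₀/t₁) + D ∫ χ/(−t)`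
  have hint1 : IntervalIntegrable (fun t => (1 - δ) * (-t)⁻¹ + D * (χ t / (-t))) volume t₀ t₁ := by
    refine (ContinuousOn.intervalIntegrable ?_)
    refine ContinuousOn.add (ContinuousOn.mul continuousOn_const ?_) (ContinuousOn.mul continuousOn_const ?_)
    · refine ContinuousOn.inv₀ (by fun_prop) fun t ht => ?_
      rw [uIcc_of_le h01.le] at ht; linarith [ht.2]
    · refine ContinuousOn.div hχ.continuousOn (by fun_prop) fun t ht => ?_
      rw [uIcc_of_le h01.le] at ht; linarith [ht.2]
  have hle : ∫ t in t₀..t₁, Λ t ≤ ∫ t in t₀..t₁, ((1 - δ) * (-t)⁻¹ + D * (χ t / (-t))) := by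
    refine intervalIntegral.integral_mono_on h01.le (hΛc.intervalIntegrable _ _) hint1 fun t ht => ?_
    have htneg : 0 < -t := by linarith [ht.2]
    rw [hΛ]; dsimp only; rw [hdw t ht]
    have hmin : min (χ t) 1 ≤ χ t := min_le_left _ _
    rw [div_eq_mul_inv, add_mul]
    have : D * min (χ t) 1 * (-t)⁻¹ ≤ D * (χ t / (-t)) := by
      rw [div_eq_mul_inv, ← mul_assoc]
      gcongr
    linarith
  have hlog : ∫ t in t₀..t₁, (-t)⁻¹ = Real.log (t₀ / t₁) := by
    have h := integral_inv_of_neg h0 h1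
    have e : (fun t : ℝ => (-t)⁻¹) = fun t => -t⁻¹ := by funext t; rw [inv_neg]
    rw [e, intervalIntegral.integral_neg, h, ← Real.log_inv, inv_div]
  have hsplit : ∫ t in t₀..t₁, ((1 - δ) * (-t)⁻¹ + D * (χ t / (-t))) =
      (1 - δ) * Real.log (t₀ / t₁) + D * ∫ t in t₀..t₁, χ t / (-t) := by
    have hi1 : IntervalIntegrable (fun t => (1 - δ) * (-t)⁻¹) volume t₀ t₁ := by
      refine (ContinuousOn.intervalIntegrable ?_)
      refine ContinuousOn.mul continuousOn_const (ContinuousOn.inv₀ (by fun_prop) fun t ht => ?_)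
      rw [uIcc_of_le h01.le] at ht; linarith [ht.2]
    have hi2 : IntervalIntegrable (fun t => D * (χ t / (-t))) volume t₀ t₁ := by
      refine (ContinuousOn.intervalIntegrable ?_)
      refine ContinuousOn.mul continuousOn_const (ContinuousOn.div hχ.continuousOn (by fun_prop) fun t ht => ?_)
      rw [uIcc_of_le h01.le] at ht; linarith [ht.2]
    rw [intervalIntegral.integral_add hi1 hi2, intervalIntegral.integral_const_mul,
      intervalIntegral.integral_const_mul, hlog]
  rw [hsplit] at hle
  -- rearrange
  have hkey : δ * Real.log (t₀ / t₁) - K ≤ D * ∫ t in t₀..t₁, χ t / (-t) := by linarith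
  calc δ / (K₁ - 1 + δ) * Real.log (t₀ / t₁) - K / (K₁ - 1 + δ)
      = (δ * Real.log (t₀ / t₁) - K) / D := by rw [hD]; ring
    _ ≤ (D * ∫ t in t₀..t₁, χ t / (-t)) / D := div_le_div_of_nonneg_right hkey hD0.le
    _ = ∫ t in t₀..t₁, χ t / (-t) := by field_simp

/-! ### The period-mean reading (DSS profiles) -/

/-- **Period mean of a clock-keeping quantity** (the `λ`-DSS reading of the clock law): if over
`n` consecutive periods of log-length `P > 0` the integrated majorant is `n I` (log-periodicity)
and the clock law gives `n P − K ≤ n I` for every `n ≥ 1`, then `P ≤ I` — an a.e. `λ`-DSS Type-I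
singularity model must have PERIOD-AVERAGED maximal gauge strain at least the dilution rate, with
no constant. [folklore] -/
theorem clock_periodMean_ge {P I K : ℝ} (h : ∀ n : ℕ, 1 ≤ n → (n : ℝ) * P - K ≤ (n : ℝ) * I) :
    P ≤ I := by
  by_contra hlt
  push Not at hlt
  have hgap : 0 < P - I := sub_pos.2 hlt
  obtain ⟨n, hn⟩ := exists_nat_gt (K / (P - I) + 1)
  have hn1 : 1 ≤ n := by
    by_contra h0
    push Not at h0
    have : n = 0 := by omega
    subst this
    have hK : 0 ≤ K := by
      have := h 1 le_rfl
      push_cast at this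
      linarith
    have : (0 : ℝ) < K / (P - I) + 1 := by positivity
    push_cast at hn
    linarith
  have key := h n hn1
  have hnK : K < (n : ℝ) * (P - I) := by
    have h1 : K / (P - I) < n := by linarith
    rwa [div_lt_iff₀ hgap] at h1
  linarith [hnK, key]

/-! ### The bet of the line is the crux (typed certificate) -/

/-- **Strain starvation ⟺ the crux** (certificate for line `Sketch`): the line's single
research-open stub `stub_clockStrainStarvation` — "on the representative of every origin-singular
class profile, for every `K` some window carries a continuous strain majorant with
`∫Λ < log(t₀/t₁) − K`" — is EQUIVALENT to `RecurrentLiouville`.  (⇐) vacuously: under the crux no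
recurrence-free singular class profile exists?  No — the crux only kills RECURRENT ones; but by the
proved reduction `recurrentReduction_proof` (item 1590) a singular class profile yields a recurrent
singular one, so under the crux there is none, and the bet is vacuous.  (⇒) the clock law
`stub_clockKeepsClock` and the bet are contradictory on any singular profile, so no class profile —
recurrent or not — is singular at the origin.  Hence the bet is the crux in costume (Disproof §E1
shape), as the card and both round-2 triagers said; recorded here kernel-checked. -/
theorem strainStarvation_iff_recurrentLiouville :
    (∀ (C : ℝ) (u : ℝ → EuclideanSpace ℝ (Fin 3) → EuclideanSpace ℝ (Fin 3))
      (p : ℝ → EuclideanSpace ℝ (Fin 3) → ℝ)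
      (G : ℝ → EuclideanSpace ℝ (Fin 3) → EuclideanSpace ℝ (Fin 3) →L[ℝ] EuclideanSpace ℝ (Fin 3))
      (v : ℝ → EuclideanSpace ℝ (Fin 3) → EuclideanSpace ℝ (Fin 3)),
      IsSuitableWeakSolutionOn (slab (EuclideanSpace ℝ (Fin 3)) (Iio 0) isOpen_Iio) 1 0 u p →
      HasWeakSpatialGradientOn (slab (EuclideanSpace ℝ (Fin 3)) (Iio 0) isOpen_Iio) u G →
      typeIBound (Iio (0 : ℝ) ×ˢ univ) u p G < ⊤ →
      HasTypeITimeDecay C u →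
      IsBackwardSingularPoint u 0 →
      IsTypeIAncientMild C v →
      (∀ᵐ z ∂(volume.restrict (Iio (0 : ℝ) ×ˢ (univ : Set (EuclideanSpace ℝ (Fin 3))))),
        uncurry u z = uncurry v z) →
      ∀ K : ℝ, ∃ t₀ t₁ : ℝ, t₀ < t₁ ∧ t₁ < 0 ∧
        ∃ Λ : ℝ → ℝ, Continuous Λ ∧
          (∀ t ∈ Set.Icc t₀ t₁, ∀ (x ξ : EuclideanSpace ℝ (Fin 3)),
            ⟪fderiv ℝ (v t) x ξ, ξ⟫ ≤ Λ t * ‖ξ‖ ^ 2) ∧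
          ∫ t in t₀..t₁, Λ t < Real.log (t₀ / t₁) - K) ↔
    Theses.RecurrentProfiles.RecurrentLiouville := by
  constructor
  · -- the bet and the clock law exclude every singular class profile
    intro hbet u p G C hsw hwg hI hdec _hrec hsing
    obtain ⟨v, hv, hae⟩ := clockKC_exists_typeI_repr hsw hI hdec
    obtain ⟨K, hK⟩ := stub_clockKeepsClock C u p G v hsw hwg hI hdec hsing hv hae
    obtain ⟨t₀, t₁, h01, h1, Λ, hΛ, hmaj, hlt⟩ := hbet C u p G v hsw hwg hI hdec hsing hv hae K
    exact absurd (hK t₀ t₁ h01 h1 Λ hΛ hmaj) (not_le.2 hlt)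
  · -- under the crux no singular class profile exists (recurrent reduction, item 1590, proved)
    intro hL C u p G v hsw hwg hI hdec hsing _hv _hae K
    obtain ⟨w, q, H, hsw', hwg', hI', hdec', hsing', hrec'⟩ :=
      recurrentReduction_proof u p G C hsw hwg hI hdec hsing
    exact absurd hsing' (hL w q H C hsw' hwg' hI' hdec' hrec')

end Summit.NavierStokesRegularity.NavierStokesRegularity.Theorems

end
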